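import Summits.BirchSwinnertonDyer.Rank1Residual.Additive.X4ThreeKuriharaCertKernelIntegral
import Literature.NumberTheory.EllipticCurves.KuriharaNumberKimStructureProofs
import Literature.NumberTheory.EllipticCurves.AnalyticRankOrderProofs
import HarnessLib

/-!
# N11 LOWER@3 Kurihara-certificate KERNEL TOOL, sequel: the binder `r_an = 0` FROM THE SAME EXACT
# MODULAR-SYMBOL VALUE the engines compute — `[0]⁺_f ≠ 0` (equivalently `δ̃₁ ≢ 0`) ⟹ `analyticRank = 0`
# (cell `b2b-bsdres`, team n1011, seat p03, OWNERS row T-a2-REC; sequel of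
# `X4ThreeKuriharaCertKernel{,Integral}.lean`)

HONEST FRAMING (cell `b2b-bsdres`, run/shared/lean/b2b/bsd-rank1-residual/, verbatim in every
file): the goal of the cell is to DELETE the COMBINATION-SHAPED residual classes of the
Birch–Swinnerton-Dyer formula for ALL analytic-rank `≤ 1` elliptic curves over `ℚ` — "full BSD
formula for every rank `≤ 1` curve in class `C`" assembled STRICTLY from published theorems — so
that the rank-`≤ 1` remainder becomes exactly the CONSTRUCTION-SHAPED classes, which are TYPED
(missing-input `Prop`s), NOT attempted. This is not "finishing BSD". Team n1011 is a RESEARCH ROUTE;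
no claim beyond the stated classes; the label X4 and the mark of RESIDUAL-MAP §I N11 (LOWER@3) are
UNCHANGED; nothing is booked. Theorems only (no definition, no named fact, no new `Prop`); the record
shape below is CONDITIONAL on the ANNOUNCED [K25] primary record `hK25s` (FLAG `Kim2025-preprint`)
exactly like its siblings.

## What this file proves

The record shapes of T-a2-REC carry the EVIDENCE binder `hr : W.analyticRank = 0` (Cremona's
`r_an`). The engines that produce the Kurihara VALUE (`msfromell` modular symbols, exact rationals)
produce at the same time the exact value `[0]⁺_f = L(E,1)/Ω⁺_f` (Kurihara's `δ̃₁`, Kim 2022 §1.4.3),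
and the tree already proves `[0]⁺_f ≠ 0 ⟹ L(E,1) ≠ 0` (`IsNewformOf.entireLFunction_one_ne_zero_of_
ratPlusSymbol_zero_ne_zero`, Mazur–Tate–Teitelbaum §I.8) and `r_an = 0 ⟺ L(E,1) ≠ 0`
(`analyticRank_eq_zero_iff_holds`, Birch–Swinnerton-Dyer 1965). Hence:

* `analyticRank_eq_zero_of_ratPlusSymbol_zero_ne_zero` — modularity (`hmod`), a modular
  parametrisation datum `D` of `W`, and `[0]⁺_{D.f} ≠ 0` ⟹ `W.analyticRank = 0`;
* `analyticRank_eq_zero_of_kuriharaNumber_one_ne_zero` — the same from `δ̃₁ ≢ 0 (mod m)` for any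
  discrete-logarithm family (`kuriharaNumber_one`);
* `X4RankZero.bsdp_three_of_intModel_of_optimal_of_towerSurj_of_kuriharaUnitAt_of_ratPlusSymbol` —
  the unit-row record shape of `X4ThreeKuriharaCertKernelIntegral.lean` with `hr` REPLACED by
  `h0 : ratPlusSymbol D.f 0 ≠ 0`: every EVIDENCE binder of a unit-row record is then either Cremona's
  optimal datum / Tamagawa reading or an EXACT modular-symbol value of `D.f` (`[0]⁺ ≠ 0`,
  `δ̃_n ≢ 0 (mod 3)`), the two quantities BOTH engines report per row (E2-AT3 `x(0)`, `L/Ω_E`).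

References: B. Mazur, J. Tate, J. Teitelbaum, Invent. Math. 84 (1986) §I.8 [MazurTateTeitelbaum1986Invent];
B. Birch, H. P. F. Swinnerton-Dyer, J. reine angew. Math. 218 (1965) [BirchSwinnertonDyer1965];
C.-H. Kim, AJM 148 (2026) §1.4.3 (`δ̃₁ = [0]⁺`) [Kim2022StructureSelmer]; C.-H. Kim (app. R. Pollack),
arXiv:2505.09121v1 Thm. 1.1, Cor. 1.7 (ANNOUNCED preprint — the reason, not a source of truth)
[Kim2025RefinedTNC]; cell files cells/n1011/skel/T-a2-REC.md §6, cells/n1011/PREDICTIONS-E2-AT3.md (S-MU′, x(0)).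
-/

noncomputable section

open scoped Classical MatrixGroups ModularForm

open CongruenceSubgroup WeierstrassCurve Literature.NumberTheory.EllipticCurves
  Literature.NumberTheory.EllipticCurves.ModularForms
  Literature.NumberTheory.EllipticCurves.Rank1Residual
  Literature.NumberTheory.EllipticCurves.Rank1Residual.Typed
  Literature.NumberTheory.EllipticCurves.AgasheRibetStein2006
  Summit.BirchSwinnertonDyer.BirchSwinnertonDyer.Rank1Residual.IntModel
  Summit.BirchSwinnertonDyer.Rank1Residual.GaloisImage

namespace Summit.BirchSwinnertonDyer.Rank1Residual.Additive

open Summit.BirchSwinnertonDyer.Rank1Residual.X4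

/-! ### §1 `r_an = 0` from the exact symbol `[0]⁺_f` -/

section LValue

variable {W : WeierstrassCurve ℚ} [W.IsElliptic] {N : ℕ} [NeZero N]

/-- **`[0]⁺_{D.f} ≠ 0 ⟹ r_an(E) = 0`**: `L(E,1) = [0]⁺_f · Ω⁺_f` with `Ω⁺_f > 0` for the newform of
`E` (`D.isNewformOf`), and `r_an = 0 ⟺ L(E,1) ≠ 0` given the entire continuation (`hmod`).
[cite: MazurTateTeitelbaum1986Invent, §I.8 (8.6)] [cite: BirchSwinnertonDyer1965] -/
theorem analyticRank_eq_zero_of_ratPlusSymbol_zero_ne_zero (hmod : hasEntireLFunction_rat)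
    (D : ModularParametrizationData W N) (h0 : ratPlusSymbol D.f 0 ≠ 0) : W.analyticRank = 0 :=
  (analyticRank_eq_zero_iff_holds (W := W) (hmod W)).mpr
    (D.isNewformOf.entireLFunction_one_ne_zero_of_ratPlusSymbol_zero_ne_zero h0)

/-- **`δ̃₁ ≢ 0 (mod m) ⟹ r_an(E) = 0`** for any discrete-logarithm family `ψ`: `δ̃₁ = \overline{[0]⁺_f}`
(`kuriharaNumber_one`, Kim 2022 §1.4.3), then `analyticRank_eq_zero_of_ratPlusSymbol_zero_ne_zero`.
[cite: Kim2022StructureSelmer, §1.4.3 (PDF p. 7)] [cite: BirchSwinnertonDyer1965] -/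
theorem analyticRank_eq_zero_of_kuriharaNumber_one_ne_zero (hmod : hasEntireLFunction_rat)
    (D : ModularParametrizationData W N) (m : ℕ) (ψ : (ℓ : ℕ) → (ZMod ℓ)ˣ →* Multiplicative (ZMod m))
    (h : kuriharaNumber D.f m 1 ψ ≠ 0) : W.analyticRank = 0 :=
  analyticRank_eq_zero_of_ratPlusSymbol_zero_ne_zero hmod D
    (ratPlusSymbol_zero_ne_zero_of_kuriharaNumber_one_ne_zero D.f m ψ h)

end LValue

/-! ### §2 The unit-row record shape with `[0]⁺_f ≠ 0` in place of `r_an = 0` -/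

section UnitRow

variable (W : WeierstrassCurve ℚ) [W.IsElliptic] [W.IsGloballyMinimal]

/-- **T-a2-REC unit-row shape, `r_an = 0` READ OFF THE SYMBOL** (PRIMARY [K25] record, int-free
sibling `X4RankZero.bsdp_three_of_intModel_of_optimal_of_towerSurj_of_kuriharaUnitAt` with `hr`
replaced by `h0 : [0]⁺_{D.f} ≠ 0`): integer model with `3 ∣ Δ`, `3 ∣ c₄`; the `3`-adic tower;
`3 ∤ ∏ c_ℓ`; an OPTIMAL datum at level `N ≤ 130000`; `[0]⁺_{D.f} ≠ 0`; ONE unit Kurihara number of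
`D.f` at a cyclic `n ∈ 𝒩₁(E,3)` ⟹ `BSD(E,3) ∧ MissingPPartAt W 3`, CONDITIONAL on `hK25s`.
FLAG `Kim2025-preprint`. Per pair; nothing booked. [claim: Kim2025RefinedTNC, status: under-review]
[cite: Kim2025RefinedTNC, Thm. 1.1 ("BSD"), Cor. 1.7 (ANNOUNCED preprint — the reason, not a source of truth)]
[cite: MazurTateTeitelbaum1986Invent, §I.8 (8.6)] [cite: AgasheRibetStein2006, Thm. 2.6 (p. 619)]
[cite: Miller2011LMS, §1 and Def. 1.1] -/
theorem X4RankZero.bsdp_three_of_intModel_of_optimal_of_towerSurj_of_kuriharaUnitAt_of_ratPlusSymbol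
    (hK25s : Kim2025.thm11_kimShaLength_of_integralPeriod_OPEN)
    (hGZK : rank_eq_analyticRank_of_analyticRank_le_one) (hmod : hasEntireLFunction_rat)
    (h26 : cremona_abs_maninConstant_eq_one_of_level_le)
    {E₀ : WeierstrassCurve ℤ} (hI : integralModelInt W = E₀)
    (hΔ : (3 : ℤ) ∣ E₀.Δ) (hc₄ : (3 : ℤ) ∣ E₀.c₄)
    (htower : ∀ n : ℕ, W.HasSurjectiveModNGaloisRep (3 ^ n : ℕ))
    (htam : ¬ 3 ∣ W.tamagawaProduct)
    {N : ℕ} [NeZero N] (hN : N ≤ 130000) (D : ModularParametrizationData W N)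
    (hopt : ∀ z ∈ D.L.lattice, ∃ w ∈ periodLattice D.f, z = D.c * w)
    (h0 : ratPlusSymbol D.f 0 ≠ 0)
    (hK : haveI : Fact (Nat.Prime 3) := ⟨Nat.prime_three⟩; X4.KuriharaUnitAt W 3 D.f) :
    haveI : Fact (Nat.Prime 3) := ⟨Nat.prime_three⟩
    BSDp W 3 ∧ MissingPPartAt W 3 :=
  X4RankZero.bsdp_three_of_intModel_of_optimal_of_towerSurj_of_kuriharaUnitAt W hK25s hGZK hmod h26 hI
    hΔ hc₄ htower (analyticRank_eq_zero_of_ratPlusSymbol_zero_ne_zero hmod D h0) htam hN D hopt hK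

end UnitRow

end Summit.BirchSwinnertonDyer.Rank1Residual.Additive

end
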